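import Summits.CriticalPhenomena.PercolationContinuityZ3.Theorems.TransplantHeisenbergConnected
import Literature.Probability.Percolation.CoveringMonotonicity
import Literature.Probability.Percolation.KestenTheoremProofs
import HarnessLib

/-!
# `p_c(Cay(H₃(ℤ))) ≤ p_c(ℤ²) = 1/2 < 1` — the abelianisation is a covering map onto the square lattice

Builds on p205010 (kernel theorem, internal audit signed; external expert review pending).  Lane
`prim-bschramm`, class C2 (memo `run/shared/lean/prim/bschramm/P3-NILPOTENT.md` §1 row "p_c ∈ (0,1)").
Proof-only sequel of `TransplantHeisenberg.lean` (p207302) / `TransplantHeisenbergConnected.lean` (p208071).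

The abelianisation `(a,b,c) ↦ (a,b)` is a graph homomorphism `Cay(H₃;A,B) →g ℤ²` mapping the four
neighbours `xA^±, xB^±` of `x` ONTO the four neighbours of its image — a (weak) covering map.  By
Campanino / Benjamini–Schramm 1996 Thm 1 / Lyons–Peres Thm 6.47 (tree theorem
`LyonsPeres2016_thm647_holds`) `θ_{ℤ²}(φ x, p) ≤ θ_{H₃}(x, p)` for `p ∈ (0,1)`, hence with Kesten's
`p_c(ℤ²) = 1/2` (`kesten_criticalProb_Z2_holds`): `θ_{H₃}(p) > 0` for every `p ∈ (1/2, 1)` and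
`p_c(H₃) ≤ 1/2`.  (The tree's Peierls device `GKZ.criticalProb_lt_one_of_latticeMap` does NOT apply to
`Cay(H₃;A,B)` directly: that graph has girth 8, so no edge-preserving finite-fibre map `ℤ² → H₃` exists —
memo §1.)  Consequence: the target `HeisenbergCriticalContinuity` is about a non-degenerate critical
point, `0 < p_c(H₃) ≤ 1/2` (the lower bound `p_c ≥ 1/3` from degree 4 is not restated here).
[cite: LyonsPeres2016, Thm. 6.47] [cite: BenjaminiSchramm1996, Thm. 1]
-/

noncomputable section

namespace Summit.CriticalPhenomena.PercolationContinuityZ3.Theorems.Heisenberg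

open MeasureTheory Literature.Probability.Percolation Literature.Probability.LatticeModels

/-- The abelianisation `(a,b,c) ↦ (a,b)` as a map to the square lattice. [folklore] -/
def abelianize (x : HV) : Site 2 := ![x 0, x 1]

/-- `abelianize (x·A) = abelianize x + e₀`. [folklore] -/
theorem abelianize_mul_genA (x : HV) : abelianize (heisMul x genA) = abelianize x + Pi.single 0 1 := by
  ext i; fin_cases i <;> simp [abelianize, heisMul, genA]

/-- `abelianize (x·B) = abelianize x + e₁`. [folklore] -/
theorem abelianize_mul_genB (x : HV) : abelianize (heisMul x genB) = abelianize x + Pi.single 1 1 := by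
  ext i; fin_cases i <;> simp [abelianize, heisMul, genB]

/-- `abelianize (x·A⁻¹) + e₀ = abelianize x`. [folklore] -/
theorem abelianize_mul_genAinv (x : HV) :
    abelianize x = abelianize (heisMul x genAinv) + Pi.single 0 1 := by
  ext i; fin_cases i <;> simp [abelianize, heisMul, genAinv]

/-- `abelianize (x·B⁻¹) + e₁ = abelianize x`. [folklore] -/
theorem abelianize_mul_genBinv (x : HV) :
    abelianize x = abelianize (heisMul x genBinv) + Pi.single 1 1 := by
  ext i; fin_cases i <;> simp [abelianize, heisMul, genBinv]

/-- The abelianisation is a graph homomorphism `Cay(H₃;A,B) →g ℤ²`. [folklore] -/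
def abelianizeHom : heisenbergGraph →g zdGraph 2 where
  toFun := abelianize
  map_rel' := by
    intro x y h
    rw [heisenbergGraph_adj] at h
    rw [zdGraph_adj_iff]
    obtain ⟨-, (h | h) | (h | h)⟩ := h
    · exact ⟨0, Or.inl (by rw [h, abelianize_mul_genA])⟩
    · exact ⟨1, Or.inl (by rw [h, abelianize_mul_genB])⟩
    · exact ⟨0, Or.inr (by rw [h, abelianize_mul_genA])⟩
    · exact ⟨1, Or.inr (by rw [h, abelianize_mul_genB])⟩

/-- **Weak covering**: the neighbourhood of `x` maps ONTO the neighbourhood of its image. [folklore] -/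
theorem abelianize_surjOn (x : HV) :
    Set.SurjOn abelianizeHom (heisenbergGraph.neighborSet x) ((zdGraph 2).neighborSet (abelianizeHom x)) := by
  intro u hu
  rw [SimpleGraph.mem_neighborSet, zdGraph_adj_iff] at hu
  obtain ⟨i, hu | hu⟩ := hu
  · fin_cases i
    · refine ⟨heisMul x genA, adj_mul_gen x (Or.inl rfl), ?_⟩
      · show abelianize (heisMul x genA) = u
        rw [abelianize_mul_genA]; exact hu.symm
    · refine ⟨heisMul x genB, adj_mul_gen x (Or.inr (Or.inl rfl)), ?_⟩
      · show abelianize (heisMul x genB) = u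
        rw [abelianize_mul_genB]; exact hu.symm
  · fin_cases i
    · refine ⟨heisMul x genAinv, adj_mul_gen x (Or.inr (Or.inr (Or.inl rfl))), ?_⟩
      · show abelianize (heisMul x genAinv) = u
        have h1 := abelianize_mul_genAinv x
        have h2 : abelianize x = u + Pi.single 0 1 := hu
        exact add_right_cancel (h1.symm.trans h2)
    · refine ⟨heisMul x genBinv, adj_mul_gen x (Or.inr (Or.inr (Or.inr rfl))), ?_⟩
      · show abelianize (heisMul x genBinv) = u
        have h1 := abelianize_mul_genBinv x
        have h2 : abelianize x = u + Pi.single 1 1 := hu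
        exact add_right_cancel (h1.symm.trans h2)

/-- `abelianize 0 = 0`. [folklore] -/
@[simp] theorem abelianize_zero : abelianizeHom 0 = (0 : Site 2) := by
  show abelianize 0 = 0
  ext i; fin_cases i <;> rfl

/-- **Covering monotonicity** (Campanino; Benjamini–Schramm Thm 1; Lyons–Peres Thm 6.47):
`θ_{ℤ²}(0, p) ≤ θ_{H₃}(0, p)` for `p ∈ (0,1)`. [cite: LyonsPeres2016, Thm. 6.47] -/
theorem theta_zd2_le_theta_heis (p : unitInterval) (hp0 : 0 < (p : ℝ)) (hp1 : (p : ℝ) < 1) :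
    theta (zdGraph 2) 0 p ≤ theta heisenbergGraph 0 p := by
  have h := LyonsPeres2016_thm647_holds heisenbergGraph (zdGraph 2) abelianizeHom abelianize_surjOn 0 p hp0 hp1
  rwa [abelianize_zero] at h

/-- **`H₃` percolates above `1/2`**: `θ_{H₃}(p) > 0` for every `p ∈ (1/2, 1)`.
[cite: LyonsPeres2016, Thm. 6.47] [cite: BenjaminiSchramm1996, Thm. 1] -/
theorem theta_heis_pos_of_gt_half (p : unitInterval) (hp : (1 : ℝ) / 2 < p) (hp1 : (p : ℝ) < 1) :
    0 < theta heisenbergGraph 0 p := by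
  have hK : criticalProb (zdGraph 2) 0 = 1 / 2 := kesten_criticalProb_Z2_holds
  have hpos : 0 < theta (zdGraph 2) 0 p := theta_pos_of_criticalProb_lt_holds _ _ _ (by rw [hK]; exact hp)
  exact hpos.trans_le (theta_zd2_le_theta_heis p (by linarith) hp1)

/-- **`p_c(Cay(H₃(ℤ);A,B)) ≤ 1/2`** (`= p_c(ℤ²)`, Kesten). [cite: BenjaminiSchramm1996, Thm. 1] -/
theorem criticalProb_heis_le_half : criticalProb heisenbergGraph 0 ≤ 1 / 2 := by
  refine le_of_forall_gt_imp_ge_of_dense fun q hq => ?_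
  by_cases hq1 : q < 1
  · have hq0 : 0 ≤ q := by linarith
    set P : unitInterval := ⟨q, hq0, hq1.le⟩ with hP
    have hθ : 0 < theta heisenbergGraph 0 P := theta_heis_pos_of_gt_half P (by simpa [hP] using hq) hq1
    refine csInf_le ⟨0, ?_⟩ (Or.inl ⟨P.2, by simpa [hP] using hθ⟩)
    rintro r (⟨hr, -⟩ | hr)
    · exact hr.1
    · rw [Set.mem_singleton_iff] at hr
      rw [hr]; exact zero_le_one
  · push Not at hq1
    exact (criticalProb_mem_Icc heisenbergGraph 0).2.trans hq1

/-- **`p_c(Cay(H₃(ℤ);A,B)) < 1`** — the hypothesis "`p_c < 1`" of Benjamini–Schramm Conj. 4 for this graph.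
[cite: BenjaminiSchramm1996, Conj. 4] -/
theorem criticalProb_heis_lt_one : criticalProb heisenbergGraph 0 < 1 :=
  criticalProb_heis_le_half.trans_lt (by norm_num)

end Summit.CriticalPhenomena.PercolationContinuityZ3.Theorems.Heisenberg
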